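import Mathlib
import Summits.Ventures.HodgeRepro.PeriodCloserC7

/-!
# PeriodCloserC7Lift — (E5), the lift `U(W) → U(V)`, from its printed local-global criterion

Blind re-derivation cell `pub-hodge-repro`, seat night-2 (gen 0).  Target tree path
`lean/Summits/Ventures/HodgeRepro/PeriodCloserC7Lift.lean`.

(E5) of the endoscopic criterion (ROUTE.md §4 item 2 (8): «(E5) the lift to V (Harris Thm 5.15 with
BC(τ) = η ⊞ η′; the two L(1, ·) finite and non-zero; local zeta integrals + a finite K-type check at the real
places)») is, in `PeriodCloserC7.lean`, the atom `I.liftNonzero (I.thetaLift (I.betaOf d))`: the theta lift of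
`τ = Θ(β)` from the definite `U(W)` (`dim W = 2`) to `U(V)` (`dim V = 3`, anisotropic) is non-zero with a non-zero
`(2,0)`-component.  This file splits that atom into its two printed halves — the non-vanishing of the
automorphic lift (Gan–Qiu–Takeda 2014, Theorem 3, the local-global criterion: every local lift non-zero and the
edge `L`-value `L(s_{3,2} + ½, τ) = L(1, τ)` non-zero, for our `n = 2`, `m = 3`, `ε_0 = 0`, `r = 0`, `s_{3,2} = ½` —
the fourth bullet `m = d(n) + 1`) and the archimedean Hodge-type statement (ROUTE-B §9.8) — and records, as
named hypotheses on admissible data, what the route derives for each of them (ROUTE.md §4 item 2 (9)(e): the local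
lifts by Gan–Ichino 2016 Thm 4.4 / Atobe–Gan 2017 Thm 10.2 after the `γ_V` twist, Mínguez 2008 at split `v`; the edge
`L`-value a product of two Hecke `L`-values at `1`, non-zero; the `K`-type table kernel-checked in `LitKTypeLine.lean`).
`E5_of_lift` then gives (E5) on every admissible datum — the clause `LocalDischarge.e5` of the chain.

Nothing here says anything about the status of the Hodge conjecture for CM abelian varieties, which is NOT
proved.
-/

set_option autoImplicit false

noncomputable section

namespace Summit.Ventures.HodgeRepro.PeriodCloser

open NumberField

variable {L : Type} [Field L] [NumberField L] [IsCMField L]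

/-- **The lift interface**: the atoms of (E5) = (P′)(iii) for the theta lift `U(W) → U(V)`, `dim W = 2`,
`dim V = 3`, `V` anisotropic (`r = 0`): the automorphic lift `Θ_{W,V}(τ)` is non-zero; it has a non-zero
`(2,0)`-component for the Kudla–Millson archimedean data (the Hodge type, an archimedean statement); the local
lifts `Θ_{W_v,V_v}(τ_v)` are non-zero; the edge `L`-value `L(s_{3,2} + ½, τ) = L(1, τ × γ_V)` (GQT14's `L(s + ½, π)`
at `s = s_{m,n} = (m − n − ε_0)/2 = ½`; N. Harris IMRN 2014 Thm 5.15: `L_E(1, BC(π) ⊗ γ³)`). -/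
structure LiftInterface (I : C7Face L) where
  /-- `Θ_{W,V}(τ) ≠ 0` as an automorphic form on `U(V)` -/
  thetaNonzero : I.Tau → Prop
  /-- the lift lands in `H^{2,0}(X)`: non-zero `(2,0)`-component for the Kudla–Millson data -/
  holomorphicType : I.Tau → Prop
  /-- the atom `liftNonzero` of the face interface is the conjunction of the two -/
  liftNonzero_iff : ∀ τ : I.Tau, I.liftNonzero τ ↔ thetaNonzero τ ∧ holomorphicType τ
  /-- the local lift `Θ_{W_v,V_v}(τ_v)` is non-zero -/
  localLiftNonzero : I.Place → I.Tau → Prop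
  /-- the edge `L`-value `L(1, τ × γ_V)` -/
  edgeLValue : I.Tau → ℂ

/-- **PRINTED — Gan–Qiu–Takeda, *The regularized Siegel–Weil formula (the second term identity) and the Rallis
inner product formula*, Invent. Math. 198 (2014), arXiv:1207.4709, Theorem 3 (Local-Global nonvanishing
criterion)** (p0006:L65–L105, VERBATIM): «Assume the same conditions on `(m, n)` as in Theorem 2 [p0006:L22–27:
`(n + ε_0) < m ≤ 2·(n + ε_0)` and `r ≤ n`].  Let `π` be a cuspidal representation of `G(U_n)` and consider its
global theta lift `Θ_{n,r}(π)` to `H(V_r)`.  Assume that `Θ_{n,j}(π) = 0` for `j < r`, so that `Θ_{n,r}(π)` is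
cuspidal.  (i) If `Θ_{n,r}(π)` is nonzero, then (a) for all places `v`, `Θ_{n,r}(π_v) ≠ 0`, and (b)
`L(s_{m,n} + ½, π) ≠ 0` i.e. nonzero holomorphic.  (ii) The converse to (i) holds when one assumes one of the
following conditions: • `ε_0 = −1`; • `ε_0 = 0` and `E_v = F_v × F_v` for all archimedean places `v` of `F`; • `ε_0 = 1`
and `F` is totally complex; • `m = d(n) + 1`.»  SPECIALISED (the cell's reading, ROUTE.md §4 item 2 (9)(e), SOURCES
row GQT14): hermitian case `ε_0 = 0`, `n = 2`, `m = 3` (so `2 < 3 ≤ 4`), `r = 0` (`V` anisotropic: the vanishing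
assumption for `j < 0` is empty and every automorphic form on the compact `U(V)` is cuspidal), `s_{3,2} = ½`,
the fourth bullet `m = d(n) + 1 = 3` in force — so (i) and its converse (ii) hold: the lift is non-zero iff every
local lift is non-zero and the edge `L`-value is non-zero. -/
def GQT14_Thm3 (I : C7Face L) (J : LiftInterface I) : Prop :=
  ∀ τ : I.Tau, J.thetaNonzero τ ↔ ((∀ v : I.Place, J.localLiftNonzero v τ) ∧ J.edgeLValue τ ≠ 0)

/-- **ROUTE-DERIVED — the local lifts of `τ = Θ(β)` are non-zero at every place** (ROUTE.md §4 item 2 (9)(e), on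
the printed dichotomy Gan–Ichino 2016 arXiv:1409.6824 Thm 4.4 / Atobe–Gan 2017 arXiv:1602.01299 Thm 10.2: a
tempered `τ_v` lifts to BOTH pure inner forms of the `3`-space unless `γ_{V,v} ∈ {χ_{W_β,v}, β♭_v χ_{W,v}^{-1} χ_{W_β,v}}`,
and the route dodges the two values by a local twist of `γ_V` realised globally; split `v`: Mínguez 2008 Thm 1(2);
unramified non-split `v ∤ 2`: the unramified correspondence, MVW 1987 Chap. 5 Thm I.10) — as a hypothesis on
admissible data. -/
def LocalLiftsNonzero (I : C7Face L) (J : LiftInterface I) : Prop :=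
  ∀ d : I.Datum, I.Admissible d → ∀ v : I.Place, J.localLiftNonzero v (I.thetaLift (I.betaOf d))

/-- **ROUTE-DERIVED — the edge `L`-value of the endoscopic `τ = Θ(β)` is non-zero** (ROUTE.md §4 item 2 (2)(iii)
and (8): `BC(τ) = η ⊞ η′`, so `L(1, τ × γ_V)` is a product of two Hecke `L`-values at `s = 1`, «finite and non-zero» —
Hecke `L`-functions do not vanish on `Re s = 1`) — as a hypothesis on admissible data. -/
def EdgeLValueNonzero (I : C7Face L) (J : LiftInterface I) : Prop :=
  ∀ d : I.Datum, I.Admissible d → J.edgeLValue (I.thetaLift (I.betaOf d)) ≠ 0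

/-- **ROUTE-DERIVED — the archimedean Hodge type** (ROUTE.md §4 item 2 (7) and (9); ROUTE-B §9.8 (d)/(d′)/(g), the
`K`-type table kernel-checked in `LitKTypeLine.lean` on Konno–Konno 2007 Lemma 5.3 / Ichino arXiv:2002.09148
Lemma 7.8 and §4.3 Thm 4.3 (Atobe's non-vanishing criterion)): for the admissible archimedean data the lift of
`Θ(β)` has a non-zero `(2,0)`-component — as a hypothesis on admissible data. -/
def HolomorphicTypeHolds (I : C7Face L) (J : LiftInterface I) : Prop :=
  ∀ d : I.Datum, I.Admissible d → J.holomorphicType (I.thetaLift (I.betaOf d))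

/-- **(E5) from its printed local-global criterion**: on every admissible datum, GQT14 Thm 3 (the `(ii)` converse,
fourth bullet) with the three route-derived clauses gives `I.E5 d` — the clause `LocalDischarge.e5` of the chain. -/
theorem E5_of_lift (I : C7Face L) (J : LiftInterface I) (hG : GQT14_Thm3 I J) (h1 : LocalLiftsNonzero I J)
    (h2 : EdgeLValueNonzero I J) (h3 : HolomorphicTypeHolds I J) (d : I.Datum) (hd : I.Admissible d) :
    I.E5 d :=
  (J.liftNonzero_iff _).mpr ⟨(hG _).mpr ⟨h1 d hd, h2 d hd⟩, h3 d hd⟩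

/-- The necessity half: if `I.E5 d` holds then every local lift of `Θ(β)` is non-zero and the edge `L`-value is
non-zero (GQT14 Thm 3 (i)). -/
theorem localLifts_of_E5 (I : C7Face L) (J : LiftInterface I) (hG : GQT14_Thm3 I J) (d : I.Datum)
    (h : I.E5 d) :
    (∀ v : I.Place, J.localLiftNonzero v (I.thetaLift (I.betaOf d))) ∧
      J.edgeLValue (I.thetaLift (I.betaOf d)) ≠ 0 :=
  (hG _).mp ((J.liftNonzero_iff _).mp h).1

/-- **The local discharge with (E5) from its printed criterion**: `LocalDischarge I` assembled from the clauses
(E1), (E2) ⟸ (R1), (E3) on admissible data and the three lift hypotheses of this file through `E5_of_lift`. -/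
theorem LocalDischarge.ofLift (I : C7Face L) (J : LiftInterface I) (hG : GQT14_Thm3 I J)
    (h1 : LocalLiftsNonzero I J) (h2 : EdgeLValueNonzero I J) (h3 : HolomorphicTypeHolds I J)
    (e1 : ∀ d : I.Datum, I.Admissible d → I.E1 d) (e2 : ∀ d : I.Datum, I.Admissible d → I.R1 d → I.E2 d)
    (e3 : ∀ d : I.Datum, I.Admissible d → I.E3 d) : LocalDischarge I :=
  ⟨e1, e2, e3, fun d hd => E5_of_lift I J hG h1 h2 h3 d hd⟩

end Summit.Ventures.HodgeRepro.PeriodCloser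

end
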